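import Summits.FinalStateConjecture.FinalStateConjecture.Theses.ZeroEnergyKerrOrBomb
import Literature.Geometry.Lorentzian.CausalityOpennessProofs
import Literature.Geometry.Lorentzian.LorentzianMetricProofs
import Literature.Geometry.Lorentzian.CauchyProblemCauchy
import Literature.Geometry.Manifold.OpenSubmanifoldMFDeriv

/-!
# `ZeroEnergyRigidity`, line `global-horizon-killing-field` — stub `stub_docIsometryTransfer`

Crux `stmt-FinalStateConjecture-10690`
(`Summit.FinalStateConjecture.FinalStateConjecture.Theses.ZeroEnergyKerrOrBomb.ZeroEnergyRigidity`),
stub S5 of the lead's skeleton: **transport of the fact-free Kerr conclusion along a d.o.c.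
isometry.**

The conclusion of the crux for a presentation `𝓑 : StationaryAFBlackHole` ("fact-free chart
form") says that the domain of outer communications `𝓑.doc = I⁺(M_ext) ∩ I⁻(M_ext)` is the range
of an injective smooth isometric immersion `Ψ` of a sub-extremal Kerr exterior
`(Kerr.exterior M a, Kerr.smoothMetric M a r₊)`.  The line re-presents `𝓑` by a presentation `𝓑'`
whose d.o.c. — the open submanifold `𝓑'.docOpens hF hP : Opens 𝓑'.carrier` (underlying set
`𝓑'.doc`) with the restricted metric `𝓑'.metric.restrict hres (𝓑'.docOpens hF hP)` — is carried
by an injective isometric immersion `Θ` onto `𝓑.doc`.  This file proves that the conclusion for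
`𝓑'` then gives the conclusion for `𝓑`, with the same parameters `(M, a)`:

* corestrict `Ψ' : Kerr.exterior M a → 𝓑'.carrier` (range `𝓑'.doc`) to
  `Ψ'' := Subtype.coind Ψ' _ : Kerr.exterior M a → 𝓑'.docOpens hF hP`; it is smooth
  (`ContMDiff.subtypeVal_comp_iff`), surjective, injective, and an isometric immersion into the
  restricted metric because the inclusion of an open submanifold has identity differential
  (`OpenSubmanifold.mfderiv_subtype_val`) and `(g|_U)_x = g_x` (`val_restrict`, `rfl`);
* `Ψ := Θ ∘ Ψ''` is injective, has range `Θ '' univ = range Θ = 𝓑.doc`, and is an isometric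
  immersion since isometric immersions compose (`IsIsometricImmersion.comp`, the chain rule for
  pullbacks).

The transfer is proved once over general manifolds (`exists_isIsometricImmersion_of_range_eq`)
and then specialised; `Kerr.exterior M a` is `Kerr.region a (Kerr.rPlus M a)` by definition, the
type over which `Kerr.smoothMetric M a (Kerr.rPlus M a)` lives.

References: B. O'Neill, *Semi-Riemannian geometry* (1983), Ch. 3, p. 57 (open submanifolds) and
p. 58 (pullbacks compose); J. M. Lee, *Introduction to Smooth Manifolds* (2013), Prop. 3.9.
-/

noncomputable section

-- `Summit.FinalStateConjecture.FinalStateConjecture.…`: summit = problem name (D-0017).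
set_option linter.dupNamespace false

namespace Summit.FinalStateConjecture.FinalStateConjecture.Theorems.ZeroEnergyRigidity.GlobalHorizonKillingField.DocIsometryTransfer

open Set Function Literature.Geometry.Lorentzian
open scoped Manifold ContDiff Topology

/-! ## Corestriction of a map to an open subset containing its range (`Subtype.coind`) -/

section Coind

variable {N : Type*} {M : Type*} [TopologicalSpace M]

/-- The corestriction `Subtype.coind f h : N → U` of `f : N → M` to an open set `U ⊆ M`
containing its range is onto as soon as `U ⊆ range f`. [folklore] -/
lemma coind_surjective_of_subset_range {f : N → M} {U : TopologicalSpace.Opens M}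
    (h : ∀ y, f y ∈ U) (hU : (U : Set M) ⊆ range f) :
    Surjective (Subtype.coind f (p := (· ∈ U)) h) := by
  rintro ⟨x, hx⟩
  obtain ⟨y, rfl⟩ := hU hx
  exact ⟨y, rfl⟩

variable {E' : Type*} [NormedAddCommGroup E'] [NormedSpace ℝ E'] {H' : Type*}
  [TopologicalSpace H'] {I' : ModelWithCorners ℝ E' H'} [TopologicalSpace N] [ChartedSpace H' N]
  {E : Type*} [NormedAddCommGroup E] [NormedSpace ℝ E] {H : Type*} [TopologicalSpace H]
  {I : ModelWithCorners ℝ E H} [ChartedSpace H M]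

/-- The corestriction of a `C^∞` map to an open submanifold containing its range is `C^∞`
(Mathlib's `ContMDiff.subtypeVal_comp_iff`: `Subtype.val ∘ Subtype.coind f h = f`). [folklore] -/
lemma contMDiff_coind {f : N → M} {U : TopologicalSpace.Opens M} (h : ∀ y, f y ∈ U)
    (hs : ContMDiff I' I ∞ f) : ContMDiff I' I ∞ (Subtype.coind f (p := (· ∈ U)) h) :=
  (ContMDiff.subtypeVal_comp_iff U (Subtype.coind f h)).mp hs

/-- The differential of the corestriction is the differential of the map: the inclusion of an
open submanifold has identity differential (`OpenSubmanifold.mfderiv_subtype_val`) and the chain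
rule applies to `Subtype.val ∘ Subtype.coind f h = f`. Lee 2013, Prop. 3.9. [folklore] -/
lemma mfderiv_coind {f : N → M} {U : TopologicalSpace.Opens M} (h : ∀ y, f y ∈ U)
    (hs : ContMDiff I' I ∞ f) (y : N) :
    mfderiv I' I (Subtype.coind f (p := (· ∈ U)) h) y = mfderiv I' I f y := by
  have hd : MDifferentiableAt I' I (Subtype.coind f (p := (· ∈ U)) h) y :=
    (contMDiff_coind h hs).mdifferentiableAt (by simp)
  have hc : mfderiv I' I (Subtype.val ∘ Subtype.coind f (p := (· ∈ U)) h) y =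
      mfderiv I' I (Subtype.coind f (p := (· ∈ U)) h) y := by
    rw [mfderiv_comp y
        (Literature.Geometry.Manifold.OpenSubmanifold.mdifferentiableAt_subtype_val _) hd,
      Literature.Geometry.Manifold.OpenSubmanifold.mfderiv_subtype_val]
    exact ContinuousLinearMap.id_comp _
  exact hc.symm

variable [IsManifold I' ∞ N] [IsManifold I ∞ M]

/-- **An isometric immersion corestricts to an isometric immersion into an open submanifold
containing its range, with the restricted metric**:
`(g|_U)_{f y}(df v, df w) = g_{f y}(df v, df w) = g_N(v, w)` (`val_restrict` and
`mfderiv_coind`). O'Neill 1983, Ch. 3, p. 57. [folklore] -/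
theorem isIsometricImmersion_coind
    {gN : PseudoRiemannianMetric I' ∞ E' (TangentSpace I' : N → Type _)}
    {gM : PseudoRiemannianMetric I ∞ E (TangentSpace I : M → Type _)}
    (hres : PseudoRiemannianMetric.contMDiff_restrict (I := I) (n := ∞) (M := M))
    {f : N → M} {U : TopologicalSpace.Opens M} (h : ∀ y, f y ∈ U)
    (hf : PseudoRiemannianMetric.IsIsometricImmersion gN gM f) :
    PseudoRiemannianMetric.IsIsometricImmersion gN (gM.restrict hres U)
      (Subtype.coind f (p := (· ∈ U)) h) := by
  refine ⟨contMDiff_coind h hf.1, fun y ↦ ?_⟩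
  rw [← hf.2 y]
  ext v w
  rw [pullbackBilin_apply, pullbackBilin_apply, mfderiv_coind h hf.1]
  rfl

/-! ## Transfer along an isometric immersion of the open submanifold -/

variable {E'' : Type*} [NormedAddCommGroup E''] [NormedSpace ℝ E''] {H'' : Type*}
  [TopologicalSpace H''] {I'' : ModelWithCorners ℝ E'' H''} {P : Type*} [TopologicalSpace P]
  [ChartedSpace H'' P] [IsManifold I'' ∞ P]

/-- **Transfer of an isometric immersion along an isometric immersion of an open submanifold
containing its range.**  If `f : (N, g_N) → (M, g_M)` is an injective isometric immersion whose
range is the open set `U`, and `Θ : (U, g_M|_U) → (P, g_P)` is an injective isometric immersion,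
then `Θ ∘ f` (corestricted) is an injective isometric immersion `(N, g_N) → (P, g_P)` with range
`range Θ` (isometric immersions compose: chain rule for pullbacks). O'Neill 1983, Ch. 3,
pp. 57–58. [folklore] -/
theorem exists_isIsometricImmersion_of_range_eq
    {gN : PseudoRiemannianMetric I' ∞ E' (TangentSpace I' : N → Type _)}
    {gM : PseudoRiemannianMetric I ∞ E (TangentSpace I : M → Type _)}
    {gP : PseudoRiemannianMetric I'' ∞ E'' (TangentSpace I'' : P → Type _)}
    (hres : PseudoRiemannianMetric.contMDiff_restrict (I := I) (n := ∞) (M := M))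
    (U : TopologicalSpace.Opens M) {Θ : U → P} (hΘinj : Injective Θ)
    (hΘiso : PseudoRiemannianMetric.IsIsometricImmersion (gM.restrict hres U) gP Θ)
    {f : N → M} (hfinj : Injective f) (hfr : range f = U)
    (hfiso : PseudoRiemannianMetric.IsIsometricImmersion gN gM f) :
    ∃ Ψ : N → P, Injective Ψ ∧ range Ψ = range Θ ∧
      PseudoRiemannianMetric.IsIsometricImmersion gN gP Ψ := by
  have h : ∀ y, f y ∈ U := fun y ↦ hfr.le (mem_range_self y)
  refine ⟨Θ ∘ Subtype.coind f h, hΘinj.comp (Subtype.coind_injective h hfinj), ?_,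
    hΘiso.comp (isIsometricImmersion_coind hres h hfiso)⟩
  rw [range_comp, (coind_surjective_of_subset_range h hfr.ge).range_eq, image_univ]

end Coind

/-! ## The stub -/

/-- **Stub S5 · docIsometryTransfer** (line `global-horizon-killing-field`, crux
`stmt-FinalStateConjecture-10690`): if the open submanifold `⟨⟨M_ext'⟩⟩ ⊆ 𝓑'` (restricted
metric) is carried by a smooth injective isometric immersion `Θ` onto `𝓑.doc`, and `𝓑'`
satisfies the fact-free Kerr conclusion (its d.o.c. is the range of an injective isometric
immersion `Ψ'` of a sub-extremal Kerr exterior), so does `𝓑`, with the same `(M, a)`: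
corestrict `Ψ'` to the open submanifold `⟨⟨M_ext'⟩⟩ = range Ψ'`, compose with `Θ` (isometric
immersions compose); the range is `Θ '' univ = 𝓑.doc` since the corestriction is onto
(`exists_isIsometricImmersion_of_range_eq` at `N := Kerr.region a r₊`, which is
`Kerr.exterior M a` by definition). O'Neill 1983, Ch. 3, pp. 57–58. [folklore] -/
theorem stub_docIsometryTransfer :
    ∀ (𝓑 𝓑' : StationaryAFBlackHole.{0}) [Kerr.Facts],
      (∃ Θ : 𝓑'.docOpens LorentzianMetric.isOpen_chronologicalFuture_holds_of_boundaryless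
          LorentzianMetric.isOpen_chronologicalPast_holds_of_boundaryless → 𝓑.carrier,
        Function.Injective Θ ∧ Set.range Θ = 𝓑.doc ∧
        PseudoRiemannianMetric.IsIsometricImmersion
          (𝓑'.metric.restrict PseudoRiemannianMetric.contMDiff_restrict_holds
            (𝓑'.docOpens LorentzianMetric.isOpen_chronologicalFuture_holds_of_boundaryless
              LorentzianMetric.isOpen_chronologicalPast_holds_of_boundaryless)).toPseudoRiemannianMetric
          𝓑.metric.toPseudoRiemannianMetric Θ) →
      (∃ (M a : ℝ), Kerr.IsSubextremal M a ∧ ∃ Ψ : Kerr.exterior M a → 𝓑'.carrier,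
        Function.Injective Ψ ∧ Set.range Ψ = 𝓑'.doc ∧
          PseudoRiemannianMetric.IsIsometricImmersion
            (Kerr.smoothMetric M a (Kerr.rPlus M a)).toPseudoRiemannianMetric
            𝓑'.metric.toPseudoRiemannianMetric Ψ) →
      ∃ (M a : ℝ), Kerr.IsSubextremal M a ∧ ∃ Ψ : Kerr.exterior M a → 𝓑.carrier,
        Function.Injective Ψ ∧ Set.range Ψ = 𝓑.doc ∧
          PseudoRiemannianMetric.IsIsometricImmersion
            (Kerr.smoothMetric M a (Kerr.rPlus M a)).toPseudoRiemannianMetric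
            𝓑.metric.toPseudoRiemannianMetric Ψ := by
  intro 𝓑 𝓑' _ hΘ hΨ'
  obtain ⟨Θ, hΘinj, hΘrange, hΘiso⟩ := hΘ
  obtain ⟨M, a, hsub, Ψ', hΨ'inj, hΨ'range, hΨ'iso⟩ := hΨ'
  obtain ⟨Ψ, h1, h2, h3⟩ := exists_isIsometricImmersion_of_range_eq
    (N := Kerr.region a (Kerr.rPlus M a)) PseudoRiemannianMetric.contMDiff_restrict_holds
    (𝓑'.docOpens LorentzianMetric.isOpen_chronologicalFuture_holds_of_boundaryless
      LorentzianMetric.isOpen_chronologicalPast_holds_of_boundaryless)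
    hΘinj hΘiso hΨ'inj hΨ'range hΨ'iso
  exact ⟨M, a, hsub, Ψ, h1, h2.trans hΘrange, h3⟩

end Summit.FinalStateConjecture.FinalStateConjecture.Theorems.ZeroEnergyRigidity.GlobalHorizonKillingField.DocIsometryTransfer

end
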